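import Summits.NavierStokesRegularity.FunctionalMining.NoGo.LogThresholdPackage
import Summits.NavierStokesRegularity.FunctionalMining.NoGo.PalinstrophyLogCertificate
import Summits.NavierStokesRegularity.FunctionalMining.NoGo.PalinstrophyLogThreshold
import HarnessLib

/-!
# NO-GO #4, qualitative asymptotic form (kernel-checked): the log door fails below a universal constant

Search for candidate a priori estimates; no regularity claim. NS FUNCTIONAL MINING — NO-GO BRANCH
(cell `pub-nsfunc`, prove seat gen 4).

* `exists_palinstrophyLogBudgetFailsBelow_fin3 : ∃ C₀ > 0, PalinstrophyLogBudgetFailsBelow (d := Fin 3) C₀`: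
  there is ONE constant `C₀ > 0` such that for EVERY log-scale `c > 0` and every `C < C₀` the typed
  K1-Q3(a) candidate `PalinstrophyLogBudget C c`
  (`d𝒫/dt ≤ C ‖ω‖_∞ 𝒫 log(e + c𝒫/ν²)` along classical Navier–Stokes solutions on `T³`) is FALSE —
  the K1-Q3 threshold `c ↦ C₀(c)` (`logBudgetThreshold`, dictionary seat) is bounded away from `0`
  UNIFORMLY in `c`;
* `exists_palinstrophyLogBudgetFailsSmallC_fin3 : ∃ κ > 0, PalinstrophyLogBudgetFailsSmallC (d := Fin 3) κ`:
  there are `κ, c₀ > 0` with `¬PalinstrophyLogBudget C c` for all `0 < c < c₀`, `C < κ log(1/c)` —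
  the threshold grows at least logarithmically as `c → 0` (the no-go seat's §5 shape, qualitative).
The finite certificates in the tree (`NoGo/PalinstrophyLogKill.lean`: `¬PalinstrophyLogBudget (1/40) c`,
`c ≤ 1`) are single instances; these are the first ASYMPTOTIC statements (all `c`, resp. `c → 0`). The
constants are inexplicit (sup-norms of derivatives of the bump profiles); the no-go seat's paper-level
values (`2/π`, Theorem T of `THRESHOLD.md`, unreviewed) are not touched, and `PalinstrophyLogThreshold`
(= `FailsBelow (2/π)`) stays open.

Proof. The N6 witness pair `U_± = G_n ± W_K` at the coupled scale `r = 1/R`, `K = R⁶`, `R = 4·2ⁿ`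
(`logThreshold_package`): vorticity `≤ M²` uniformly, Euclidean GAIN `N(U)/(M∫‖ΔU‖²) ≥ nJ/(8Me)`
linear in `n`, all Sobolev sizes `≤ κ 2^{32n}`. Planting `8·U(8(·−q))` in `T³` and running the
certificate reduction `not_palinstrophyLogBudget_of_bounds` at the amplitude `A = 2D₀/N₀` turns the
static violation into `8 C M e Λ < n J` for any `Λ ≥ log(e + cΦ4^{32n})`
(`not_palinstrophyLogBudget_of_package`); `Λ = log(e + cΦ) + 64n` gives the uniform theorem with
`C₀ = J/(1024Me)`, and `Λ = 2` on the range `cΦ4^{32n} ≤ 1` gives the small-`c` theorem with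
`κ = J/(2048Me)`. Nothing here is a statement about solutions of Navier–Stokes beyond local existence
from a smooth datum and the `H²` balance (tree theorems inside the door); it is a negative result
about ONE family of candidate a priori inequalities. [ours — internal, unreviewed]
-/

noncomputable section

open MeasureTheory Set Function Filter Real
open scoped ContDiff Topology Laplacian InnerProductSpace RealInnerProductSpace

namespace Summit.NavierStokesRegularity.FunctionalMining

open Literature.Analysis.FunctionSpaces Literature.Analysis.FluidPDE Sep3 LogDoor

namespace LogDoor

/-- Logarithm bookkeeping: for `Y ≤ Z` (`c, Y ≥ 0`), `log(e + cY) ≤ log(e + cZ)`. [folklore] -/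
theorem log_exp_one_add_mono {c Y Z : ℝ} (hc : 0 ≤ c) (hY0 : 0 ≤ Y) (hY : Y ≤ Z) :
    Real.log (Real.exp 1 + c * Y) ≤ Real.log (Real.exp 1 + c * Z) :=
  Real.log_le_log (by positivity) (by nlinarith [mul_le_mul_of_nonneg_left hY hc])

/-- `log(e + X·2^{64n}) ≤ log(e + X) + 64 n` for `X ≥ 0`. [folklore] -/
theorem log_exp_one_add_pow_le {X : ℝ} (hX : 0 ≤ X) (n : ℕ) :
    Real.log (Real.exp 1 + X * 2 ^ (64 * n)) ≤ Real.log (Real.exp 1 + X) + 64 * n := by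
  have he : 0 < Real.exp 1 := Real.exp_pos 1
  have h2 : (1 : ℝ) ≤ 2 ^ (64 * n) := one_le_pow₀ (by norm_num)
  have hle : Real.exp 1 + X * 2 ^ (64 * n) ≤ (Real.exp 1 + X) * 2 ^ (64 * n) := by nlinarith
  have hlog2 : Real.log 2 ≤ 1 := by
    have := Real.log_le_sub_one_of_pos (show (0 : ℝ) < 2 by norm_num); linarith
  calc Real.log (Real.exp 1 + X * 2 ^ (64 * n)) ≤ Real.log ((Real.exp 1 + X) * 2 ^ (64 * n)) :=
        Real.log_le_log (by positivity) hle
    _ = Real.log (Real.exp 1 + X) + (64 * n : ℕ) * Real.log 2 := by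
        rw [Real.log_mul (by positivity) (by positivity), Real.log_pow]
    _ ≤ Real.log (Real.exp 1 + X) + 64 * n := by
        have : ((64 * n : ℕ) : ℝ) * Real.log 2 ≤ (64 * n : ℕ) * 1 :=
          mul_le_mul_of_nonneg_left hlog2 (by positivity)
        push_cast at this ⊢; linarith

/-- `log(e + X) ≤ 2` for `0 ≤ X ≤ 1`. [folklore] -/
theorem log_exp_one_add_le_two {X : ℝ} (hX0 : 0 ≤ X) (hX : X ≤ 1) : Real.log (Real.exp 1 + X) ≤ 2 := by
  rw [Real.log_le_iff_le_exp (by positivity)]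
  have h1 : Real.exp 1 + 1 ≤ Real.exp 2 := by
    have e1 : Real.exp 2 = Real.exp 1 * Real.exp 1 := by rw [← Real.exp_add]; norm_num
    have h : (2 : ℝ) ≤ Real.exp 1 := by linarith [Real.add_one_le_exp (1 : ℝ)]
    rw [e1]; nlinarith
  linarith

/-- **The endgame of the log-door threshold, given the package.** For `n ≥ n₀`, `n ≥ 1`, `c, C' ≥ 0`
and any `Λ ≥ log(e + c·Φ·2^{64n})` (`Φ = e(8⁵κ+1)²/(32768 J² x₀)`), the inequality `8 C' M e Λ < n J`
refutes `PalinstrophyLogBudget C' c` (plant the package witness at scale `8`, certificate reduction at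
`A = 2D₀/N₀`). [ours] -/
theorem not_palinstrophyLogBudget_of_package {M Jc e0 x0 κ : ℝ} {n₀ : ℕ} (hM : 0 < M) (hJc : 0 < Jc)
    (he0 : 0 < e0) (hx0 : 0 < x0) (hκ : 0 ≤ κ)
    (hpack : ∀ n : ℕ, n₀ ≤ n → ∃ (U : E3 → E3) (X : ℝ),
      ContDiff ℝ ∞ U ∧ tsupport U ⊆ Metric.closedBall 0 2 ∧
      (∀ y, LinearMap.trace ℝ E3 (fderiv ℝ U y : E3 →ₗ[ℝ] E3) = 0) ∧
      (∀ y, eVortSq U y ≤ M ^ 2) ∧ x0 ≤ X ∧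
      (n : ℝ) * Jc * X ≤ 2 * (-(∫ y, ⟪fderiv ℝ U y (U y), Δ (Δ U) y⟫)) ∧
      (∫ y, ‖Δ U y‖ ^ 2) ≤ 4 * e0 * X ∧
      (∫ y, ∑ i : Fin 3, ‖fderiv ℝ (Δ U) y (EuclideanSpace.single i 1)‖ ^ 2) ≤ κ * 2 ^ (32 * n))
    {n : ℕ} (hn₀ : n₀ ≤ n) (hn1 : 1 ≤ n) {c C' Λ : ℝ} (hc : 0 ≤ c) (hC' : 0 ≤ C')
    (hΛ : Real.log (Real.exp 1 + c * (e0 * (8 ^ 5 * κ + 1) ^ 2 / (32768 * Jc ^ 2 * x0) * 2 ^ (64 * n))) ≤ Λ)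
    (hmain : 8 * C' * M * e0 * Λ < n * Jc) : ¬ PalinstrophyLogBudget (d := Fin 3) C' c := by
  have hn1' : (1 : ℝ) ≤ n := by exact_mod_cast hn1
  obtain ⟨U, X, hU, hUs, hdiv, hvort, hXx0, hN, hP, hD⟩ := hpack n hn₀
  have hX0 : 0 < X := lt_of_lt_of_le hx0 hXx0
  -- plant `8 • U(8(· - q))` in the unit cube and periodise
  obtain ⟨q, hq⟩ : ∃ q : E3, ∀ i, q i = 1 / 2 := ⟨WithLp.toLp 2 fun _ => 1 / 2, fun _ => rfl⟩
  have hc8 : (8 : ℝ) ≤ 8 := le_rfl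
  have hdiv' : ∀ y, VectorCalculus.divergence U y = 0 := hdiv
  obtain ⟨hsm, hdf, -, -, -, hDn⟩ := planted_facts hU hUs hdiv' hq hc8
  obtain ⟨hσn, hgn⟩ := planted_facts2 hU hUs hq hc8
  have hg : ContDiff ℝ ∞ (fun y => (8 : ℝ) • U ((8 : ℝ) • (y + -q))) := contDiff_plant hU 8 (-q)
  have hgs : tsupport (fun y => (8 : ℝ) • U ((8 : ℝ) • (y + -q))) ⊆ {y | ∀ i, y i ∈ Ioo (0 : ℝ) 1} := by
    intro y hy
    have h1 := tsupport_plant (by norm_num : (0 : ℝ) < 8) hUs (-q) hy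
    rw [neg_neg, Metric.mem_closedBall, dist_eq_norm] at h1
    have h2 : ‖y - q‖ < 1 / 2 := by linarith
    simpa using (Torus.add_mem_unitCube_of_norm_lt hq h2).2
  set w := Torus.periodize fun y => (8 : ℝ) • U ((8 : ℝ) • (y + -q)) with hwdef
  have hω : ∀ x, torusVorticitySqAt w x ≤ (64 * M) ^ 2 := fun x => by
    rw [hwdef, torusVorticitySqAt_periodize hg hgs, eVortSq_plant U (by norm_num) (-q)]
    have := hvort ((8 : ℝ) • (Torus.repr x + -q))
    nlinarith
  -- the certificate data
  obtain ⟨N₀, hN₀def⟩ : ∃ x : ℝ, x = 8 ^ 5 * ((n : ℝ) * Jc * X / 2) := ⟨_, rfl⟩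
  obtain ⟨P₀, hP₀def⟩ : ∃ x : ℝ, x = 8 ^ 3 * (4 * e0 * X) := ⟨_, rfl⟩
  obtain ⟨D₀, hD₀def⟩ : ∃ x : ℝ, x = 8 ^ 5 * (κ * 2 ^ (32 * n)) + 1 := ⟨_, rfl⟩
  have hN₀ : 0 < N₀ := by rw [hN₀def]; positivity
  have hP₀ : 0 < P₀ := by rw [hP₀def]; positivity
  have hD₀ : 0 < D₀ := by rw [hD₀def]; positivity
  obtain ⟨A, hAdef⟩ : ∃ x : ℝ, x = 2 * D₀ / N₀ := ⟨_, rfl⟩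
  have hA : 0 < A := by rw [hAdef]; positivity
  have hNw : N₀ ≤ palinstrophyProduction w := by
    show N₀ ≤ -∫ x, ⟪Torus.convect w w x, Torus.laplacian (Torus.laplacian w) x⟫
    rw [hwdef, hσn, hN₀def]
    have e : -((8 : ℝ) ^ 5 * ∫ z, ⟪fderiv ℝ U z (U z), Δ (Δ U) z⟫) =
        8 ^ 5 * (-(∫ z, ⟪fderiv ℝ U z (U z), Δ (Δ U) z⟫)) := by ring
    rw [e]
    exact mul_le_mul_of_nonneg_left (by linarith) (by positivity)
  have hPw : torusPalinstrophy w ≤ P₀ := by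
    show (∫ x, ‖Torus.laplacian w x‖ ^ 2) ≤ P₀
    rw [hwdef, hDn, hP₀def]
    exact mul_le_mul_of_nonneg_left hP (by positivity)
  have hDw : palinstrophyDissipation w ≤ D₀ := by
    show Torus.gradNormSq (Torus.laplacian w) ≤ D₀
    rw [hwdef, hgn, hD₀def]
    have := mul_le_mul_of_nonneg_left hD (by positivity : (0 : ℝ) ≤ 8 ^ 5)
    linarith
  -- the real inequality
  have h2DA : 2 * D₀ / A = N₀ := by rw [hAdef]; field_simp
  have hA2P : A ^ 2 * P₀ = e0 * D₀ ^ 2 / (32768 * (n : ℝ) ^ 2 * Jc ^ 2 * X) := by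
    rw [hAdef, hP₀def, hN₀def]; field_simp; ring
  have hD₀le : D₀ ≤ (8 ^ 5 * κ + 1) * 2 ^ (32 * n) := by
    have h2 : (1 : ℝ) ≤ 2 ^ (32 * n) := one_le_pow₀ (by norm_num)
    rw [hD₀def]; nlinarith
  have hY : A ^ 2 * P₀ ≤ e0 * (8 ^ 5 * κ + 1) ^ 2 / (32768 * Jc ^ 2 * x0) * 2 ^ (64 * n) := by
    rw [hA2P]
    have hnum : e0 * D₀ ^ 2 ≤ e0 * ((8 ^ 5 * κ + 1) * 2 ^ (32 * n)) ^ 2 :=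
      mul_le_mul_of_nonneg_left (pow_le_pow_left₀ hD₀.le hD₀le 2) he0.le
    have hden : 32768 * Jc ^ 2 * x0 ≤ 32768 * (n : ℝ) ^ 2 * Jc ^ 2 * X := by
      have hn2 : (1 : ℝ) ≤ (n : ℝ) ^ 2 := one_le_pow₀ hn1'
      have hJ2 : 0 ≤ Jc ^ 2 := sq_nonneg _
      calc 32768 * Jc ^ 2 * x0 = 32768 * 1 * Jc ^ 2 * x0 := by ring
        _ ≤ 32768 * (n : ℝ) ^ 2 * Jc ^ 2 * X := by gcongr
    have e : e0 * ((8 ^ 5 * κ + 1) * 2 ^ (32 * n)) ^ 2 / (32768 * Jc ^ 2 * x0) =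
        e0 * (8 ^ 5 * κ + 1) ^ 2 / (32768 * Jc ^ 2 * x0) * 2 ^ (64 * n) := by
      have : ((2 : ℝ) ^ (32 * n)) ^ 2 = 2 ^ (64 * n) := by rw [← pow_mul]; ring_nf
      rw [mul_pow, this]; ring
    rw [← e]
    exact div_le_div₀ (by positivity) hnum (by positivity) hden
  have hlog : Real.log (Real.exp 1 + c * (A ^ 2 * P₀)) ≤ Λ :=
    (log_exp_one_add_mono hc (by positivity) hY).trans hΛ
  have harith : C' * (64 * M) * P₀ * Real.log (Real.exp 1 + c * (A ^ 2 * P₀)) < 2 * N₀ - 2 * D₀ / A := by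
    rw [h2DA]
    have hcoef : 0 ≤ C' * (64 * M) * P₀ := by positivity
    have h1 : C' * (64 * M) * P₀ * Real.log (Real.exp 1 + c * (A ^ 2 * P₀)) ≤ C' * (64 * M) * P₀ * Λ :=
      mul_le_mul_of_nonneg_left hlog hcoef
    have e1 : C' * (64 * M) * P₀ * Λ = 16384 * X * (8 * C' * M * e0 * Λ) := by rw [hP₀def]; ring
    have e2 : 2 * N₀ - N₀ = 16384 * X * ((n : ℝ) * Jc) := by rw [hN₀def]; ring
    rw [e2]
    calc C' * (64 * M) * P₀ * Real.log (Real.exp 1 + c * (A ^ 2 * P₀))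
        ≤ C' * (64 * M) * P₀ * Λ := h1
      _ = 16384 * X * (8 * C' * M * e0 * Λ) := e1
      _ < 16384 * X * ((n : ℝ) * Jc) := mul_lt_mul_of_pos_left hmain (by positivity)
  exact not_palinstrophyLogBudget_of_bounds (Fintype.card_fin 3) hC' hc hsm hdf
    (by positivity : (0 : ℝ) ≤ 64 * M) hA hNw hPw hDw hω harith

/-- **NO-GO #4, qualitative asymptotic form (kernel-checked).** There is `C₀ > 0` such that the log
door K1-Q3(a) fails for every `c > 0` and every `C < C₀`:
`∃ C₀ > 0, PalinstrophyLogBudgetFailsBelow (d := Fin 3) C₀`. Search for candidate a priori estimates;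
no regularity claim. [ours] -/
theorem exists_palinstrophyLogBudgetFailsBelow_fin3 :
    ∃ C₀ : ℝ, 0 < C₀ ∧ PalinstrophyLogBudgetFailsBelow (d := Fin 3) C₀ := by
  obtain ⟨M, Jc, e0, x0, κ, n₀, hM, hJc, he0, hx0, hκ, hpack⟩ := logThreshold_package
  refine ⟨Jc / (1024 * M * e0), by positivity, ?_⟩
  intro c hc C hC hPLB
  -- WLOG `C ≥ 0`
  have hC'0 : 0 ≤ max C 0 := le_max_right _ _
  have hC'lt : max C 0 < Jc / (1024 * M * e0) := max_lt hC (by positivity)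
  have hPLB' : PalinstrophyLogBudget (d := Fin 3) (max C 0) c := hPLB.of_le (le_max_left _ _) hC'0 hc.le le_rfl
  -- the log constant and the choice of `n`
  obtain ⟨Φ, hΦdef⟩ : ∃ x : ℝ, x = e0 * (8 ^ 5 * κ + 1) ^ 2 / (32768 * Jc ^ 2 * x0) := ⟨_, rfl⟩
  have hΦ0 : 0 ≤ Φ := by rw [hΦdef]; positivity
  obtain ⟨Lc, hLcdef⟩ : ∃ x : ℝ, x = Real.log (Real.exp 1 + c * Φ) := ⟨_, rfl⟩
  obtain ⟨n, hn₀, hn1, hnL⟩ : ∃ n : ℕ, n₀ ≤ n ∧ 1 ≤ n ∧ 16 * max C 0 * M * e0 * Lc / Jc < n := by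
    refine ⟨max n₀ (⌈16 * max C 0 * M * e0 * Lc / Jc⌉₊ + 1), le_max_left _ _, ?_, ?_⟩
    · exact le_trans (by omega) (le_max_right _ _)
    · have h1 := Nat.le_ceil (16 * max C 0 * M * e0 * Lc / Jc)
      have h2 : ((⌈16 * max C 0 * M * e0 * Lc / Jc⌉₊ + 1 : ℕ) : ℝ) ≤
          (max n₀ (⌈16 * max C 0 * M * e0 * Lc / Jc⌉₊ + 1) : ℕ) := by exact_mod_cast le_max_right _ _
      push_cast at h2 ⊢; linarith
  refine not_palinstrophyLogBudget_of_package hM hJc he0 hx0 hκ hpack hn₀ hn1 hc.le hC'0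
    (Λ := Lc + 64 * n) ?_ ?_ hPLB'
  · rw [hLcdef, ← hΦdef, ← mul_assoc]
    have h := log_exp_one_add_pow_le (mul_nonneg hc.le hΦ0) n
    rwa [mul_assoc] at h ⊢
  · have hC'le : max C 0 * (1024 * M * e0) ≤ Jc :=
      ((lt_div_iff₀ (by positivity : (0 : ℝ) < 1024 * M * e0)).1 hC'lt).le
    have k1 : 8 * max C 0 * M * e0 * (64 * n) ≤ (n : ℝ) * Jc / 2 := by
      have h := mul_le_mul_of_nonneg_right hC'le (Nat.cast_nonneg n : (0 : ℝ) ≤ n)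
      linarith
    have k2 : 8 * max C 0 * M * e0 * Lc < (n : ℝ) * Jc / 2 := by
      have := (div_lt_iff₀ hJc).1 hnL
      linarith
    linarith

/-- **NO-GO #4, small-`c` form (kernel-checked).** There are `κ, c₀ > 0` such that for all
`0 < c < c₀` and all `C < κ log(1/c)` the log door fails:
`∃ κ > 0, PalinstrophyLogBudgetFailsSmallC (d := Fin 3) κ` — the threshold `C₀(c)` grows at least
logarithmically as `c → 0`. Search for candidate a priori estimates; no regularity claim. [ours] -/
theorem exists_palinstrophyLogBudgetFailsSmallC_fin3 :
    ∃ κ : ℝ, 0 < κ ∧ PalinstrophyLogBudgetFailsSmallC (d := Fin 3) κ := by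
  obtain ⟨M, Jc, e0, x0, κ, n₀, hM, hJc, he0, hx0, hκ, hpack⟩ := logThreshold_package
  obtain ⟨Φ, hΦdef⟩ : ∃ x : ℝ, x = e0 * (8 ^ 5 * κ + 1) ^ 2 / (32768 * Jc ^ 2 * x0) := ⟨_, rfl⟩
  have hΦ : 0 < Φ := by rw [hΦdef]; positivity
  -- `κ₀ = J/(2048 M e)`, `c₀ = min(e^{-128}/Φ², e^{-64(n₀+2)}/Φ)`
  refine ⟨Jc / (2048 * M * e0), by positivity,
    min (Real.exp (-128) / Φ ^ 2) (Real.exp (-(64 * (n₀ + 2))) / Φ), by positivity, ?_⟩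
  intro c hc hcc₀ C hC hPLB
  have hc1 : c ≤ Real.exp (-128) / Φ ^ 2 := hcc₀.le.trans (min_le_left _ _)
  have hc2 : c ≤ Real.exp (-(64 * (n₀ + 2))) / Φ := hcc₀.le.trans (min_le_right _ _)
  -- `L = log(1/(cΦ)) ≥ 64(n₀+2)` and `≥ 128 + log Φ`; choose `n = ⌊L / (64 log 2)⌋`
  have hcΦ : 0 < c * Φ := mul_pos hc hΦ
  obtain ⟨L, hLdef⟩ : ∃ x : ℝ, x = Real.log (1 / (c * Φ)) := ⟨_, rfl⟩
  have hL1 : 64 * ((n₀ : ℝ) + 2) ≤ L := by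
    rw [hLdef, ← Real.log_exp (64 * ((n₀ : ℝ) + 2))]
    apply Real.log_le_log (Real.exp_pos _)
    rw [le_div_iff₀ hcΦ]
    have := (le_div_iff₀ hΦ).1 hc2
    have e : Real.exp (64 * ((n₀ : ℝ) + 2)) * Real.exp (-(64 * (n₀ + 2))) = 1 := by
      rw [← Real.exp_add]; norm_num
    nlinarith [Real.exp_pos (64 * ((n₀ : ℝ) + 2))]
  have e1 : Real.log (1 / c) = L + Real.log Φ := by
    rw [hLdef, one_div, one_div, Real.log_inv, Real.log_inv, Real.log_mul hc.ne' hΦ.ne']; ring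
  have hL2 : 128 + Real.log Φ ≤ L := by
    rw [hLdef, ← Real.log_exp 128, ← Real.log_mul (Real.exp_pos _).ne' hΦ.ne']
    apply Real.log_le_log (by positivity)
    rw [le_div_iff₀ hcΦ]
    have := (le_div_iff₀ (by positivity : (0 : ℝ) < Φ ^ 2)).1 hc1
    have e : Real.exp 128 * Real.exp (-128) = 1 := by rw [← Real.exp_add]; norm_num
    nlinarith [Real.exp_pos (128 : ℝ), hΦ]
  have hL0 : 0 ≤ L := by linarith [show (0 : ℝ) ≤ n₀ from Nat.cast_nonneg _]
  have hlog2 : 0 < Real.log 2 := Real.log_pos (by norm_num)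
  have hlog2' : Real.log 2 ≤ 1 := by
    have := Real.log_le_sub_one_of_pos (show (0 : ℝ) < 2 by norm_num); linarith
  set n : ℕ := ⌊L / (64 * Real.log 2)⌋₊ with hndef
  have hnle : (n : ℝ) ≤ L / (64 * Real.log 2) := Nat.floor_le (by positivity)
  have hnge : L / (64 * Real.log 2) - 1 ≤ n := by
    have := Nat.lt_floor_add_one (L / (64 * Real.log 2)); linarith
  have hLdiv : L / 64 ≤ L / (64 * Real.log 2) := by
    rw [div_le_div_iff₀ (by norm_num) (by positivity)]; nlinarith
  -- `n ≥ n₀ + 1 ≥ 1`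
  have hn_real : (n₀ : ℝ) + 1 ≤ n := by
    have : (n₀ : ℝ) + 2 ≤ L / 64 := by rw [le_div_iff₀ (by norm_num)]; linarith
    linarith
  have hn₀ : n₀ ≤ n := by exact_mod_cast (by linarith : (n₀ : ℝ) ≤ n)
  have hn1r : (1 : ℝ) ≤ n := by
    have : (0 : ℝ) ≤ n₀ := Nat.cast_nonneg _
    linarith
  have hn1 : 1 ≤ n := by exact_mod_cast hn1r
  -- the range condition `c Φ 2^{64 n} ≤ 1`
  have hrange : c * Φ * 2 ^ (64 * n) ≤ 1 := by
    have h64 : (64 : ℝ) * n * Real.log 2 ≤ L := by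
      have := (le_div_iff₀ (by positivity : (0 : ℝ) < 64 * Real.log 2)).1 hnle; linarith
    have hpow : (2 : ℝ) ^ (64 * n) ≤ 1 / (c * Φ) := by
      have e : (2 : ℝ) ^ (64 * n) = Real.exp ((64 * n : ℕ) * Real.log 2) := by
        rw [Real.exp_nat_mul, Real.exp_log (by norm_num)]
      rw [e, ← Real.exp_log (show 0 < 1 / (c * Φ) by positivity), ← hLdef]
      exact Real.exp_le_exp.2 (by push_cast; linarith)
    rw [le_div_iff₀ hcΦ] at hpow
    linarith
  -- WLOG `C ≥ 0`, and `max C 0 < n J /(16 M e)`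
  have hC'0 : 0 ≤ max C 0 := le_max_right _ _
  have hPLB' : PalinstrophyLogBudget (d := Fin 3) (max C 0) c := hPLB.of_le (le_max_left _ _) hC'0 hc.le le_rfl
  have hClog : Jc / (2048 * M * e0) * Real.log (1 / c) ≤ (n : ℝ) * Jc / (16 * M * e0) := by
    -- `log(1/c) = L + log Φ ≤ 2L − 128`, and `L/64 − 1 ≤ n` ⇒ `log(1/c) ≤ 128 n`
    have h1 : Real.log (1 / c) ≤ 128 * n := by rw [e1]; nlinarith
    have hpos : 0 < 16 * M * e0 := by positivity
    rw [div_mul_eq_mul_div, div_le_div_iff₀ (by positivity) hpos]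
    nlinarith [mul_pos hJc hpos, mul_pos hM he0]
  have hmain : 8 * max C 0 * M * e0 * 2 < n * Jc := by
    have hlt : max C 0 < (n : ℝ) * Jc / (16 * M * e0) := by
      rcases le_or_gt C 0 with h | h
      · rw [max_eq_right h]; positivity
      · rw [max_eq_left h.le]; exact hC.trans_le hClog
    have := (lt_div_iff₀ (by positivity : (0 : ℝ) < 16 * M * e0)).1 hlt
    linarith
  refine not_palinstrophyLogBudget_of_package hM hJc he0 hx0 hκ hpack hn₀ hn1 hc.le hC'0 (Λ := 2) ?_ hmain hPLB'
  rw [← hΦdef, ← mul_assoc]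
  exact log_exp_one_add_le_two (by positivity) hrange

end LogDoor

/-- **Typed target (no-go N10/K1-Q3, qualitative form): the log door fails below SOME positive
constant, uniformly in the log-scale `c`** — `∃ C₀ > 0, PalinstrophyLogBudgetFailsBelow (d := Fin 3) C₀`.
Stated at `d = Fin 3` so that the audit attaches the witness below. Search for candidate a priori
estimates; no regularity claim — nothing is asserted by the definition. [ours] -/
def PalinstrophyLogBudgetFailsBelowPos : Prop :=
  ∃ C₀ : ℝ, 0 < C₀ ∧ PalinstrophyLogBudgetFailsBelow (d := Fin 3) C₀

/-- `PalinstrophyLogBudgetFailsBelowPos` HOLDS (kernel-checked). [ours] -/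
theorem palinstrophyLogBudgetFailsBelowPos_holds : PalinstrophyLogBudgetFailsBelowPos :=
  LogDoor.exists_palinstrophyLogBudgetFailsBelow_fin3

/-- **Typed target (small-`c` form): `∃ κ > 0, PalinstrophyLogBudgetFailsSmallC (d := Fin 3) κ`.**
Nothing is asserted by the definition. [ours] -/
def PalinstrophyLogBudgetFailsSmallCPos : Prop :=
  ∃ κ : ℝ, 0 < κ ∧ PalinstrophyLogBudgetFailsSmallC (d := Fin 3) κ

/-- `PalinstrophyLogBudgetFailsSmallCPos` HOLDS (kernel-checked). [ours] -/
theorem palinstrophyLogBudgetFailsSmallCPos_holds : PalinstrophyLogBudgetFailsSmallCPos :=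
  LogDoor.exists_palinstrophyLogBudgetFailsSmallC_fin3

open LogDoor in
/-- **NO-GO #4 (qualitative), exported:** `∃ C₀ > 0` with `PalinstrophyLogBudgetFailsBelow C₀` on
`T³`; in particular for every `c > 0` there is a FALSE instance `¬PalinstrophyLogBudget C₀ c` with
`C₀ > 0` independent of `c`. Search for candidate a priori estimates; no regularity claim. [ours] -/
theorem palinstrophyLogBudget_failsBelow_some_pos :
    ∃ C₀ : ℝ, 0 < C₀ ∧ ∀ c : ℝ, 0 < c → ¬ PalinstrophyLogBudget (d := Fin 3) C₀ c ∧
      ∀ C : ℝ, C < C₀ → ¬ PalinstrophyLogBudget (d := Fin 3) C c := by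
  obtain ⟨C₀, hC₀, h⟩ := exists_palinstrophyLogBudgetFailsBelow_fin3
  refine ⟨C₀ / 2, by positivity, fun c hc => ⟨h c hc _ (by linarith), fun C hC => h c hc C (by linarith)⟩⟩

end Summit.NavierStokesRegularity.FunctionalMining

end
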